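import Summits.CriticalPhenomena.PercolationContinuityZ3.Theorems.Transplant.BoxProdZ2FibreReach
import Summits.CriticalPhenomena.PercolationContinuityZ3.Theorems.Transplant.BoxProdZ2TubeLevels
import Summits.CriticalPhenomena.PercolationContinuityZ3.Theorems.Transplant.KNLevelsStepIV
import HarnessLib

/-!
# The collar estimate: inside a region of bounded planar extent the cluster of the source rarely reaches the fibre edge of the window
# (BLUEPRINT-I-PHI §0 `cylTail`, §2 "Rw last"; the loss term of the edge-contact remedy for the tube-level target lemma)

builds on p205010 (kernel theorem, internal audit signed; external expert review pending) — nothing in this file uses p205010.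
Lane `prim-bschramm`, seat `prim-bschramm-p3` (Φ3-prod wiring; for the CALLER of `KNLevels.TargetProperty` on tube levels — Lemmas 11/12-prod);
helper file (`--supports stmt-CriticalPhenomena-4575 --as helper`).

Contacts of a tube level near the fibre edge of the window `π = B_X(xe, Rw)` have no room for the Step-IV target route; the caller adds
their faces to the target and loses `P_W(o ↔ collar inside D)`.  This file bounds that loss:
* `reachFar xe R D o` — the event that `o` is joined INSIDE `D` to a vertex of `D` with fibre coordinate outside `B_X(xe, R)`;
  `reachFar_subset_fibReach` — for `D ⊆ π × Λ_n` it implies the fibre reach event `fibReach xe n R o` of `BoxProdZ2FibreReach`;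
* `prob_reachFar_le` — hence `P_p(reachFar) ≤ P_p(fibReach xe n R o)`, which tends to `0` as `R → ∞` for fixed `n`
  (`tendsto_prob_fibReach_of_tubeSubcritical`), stated as `exists_prob_reachFar_le`: `∀ η > 0, ∃ R₀, ∀ R ≥ R₀, ∀ Rw, ∀ D ⊆ π × Λ_n, P_p ≤ η`;
* `real_reachFar_eq` — the same probability under the exploration's weighting `W` (subbox of the tube graph on `D`:
  `IsSubbox.real_eq_bondPercolation` + `real_eq_of_determinedBy_window`).

[cite: KozmaNitzan2024, §4 Lemma 10 (p. 17) — the ℤ^d model has no window] [cite: MartineauSevero2019, Cor. 2.2]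
-/

noncomputable section

open MeasureTheory Filter
open scoped Topology

namespace Summit.CriticalPhenomena.PercolationContinuityZ3.Theorems

namespace Transplant

namespace BoxProdZ2

open Literature.Probability.Percolation Literature.Probability.LatticeModels SimpleGraph KNLevels
open Literature.Barriers.CriticalPhenomena (graphBall graphBall_finite mem_graphBall_self graphBall_mono)

variable {W : Type} [DecidableEq W] (X : SimpleGraph W) [X.LocallyFinite]

/-- **The collar event**: `o` is joined inside `D` to a vertex of `D` whose fibre coordinate lies outside `B_X(xe, R)`. [folklore] -/
def reachFar (xe : W) (R : ℕ) (D : Finset (W × Site 2)) (o : W × Site 2) : Set (BondConfig (W × Site 2)) :=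
  linkIn (↑D : Set (W × Site 2)) {o} (D.filter fun v => v.1 ∉ ballFin X xe R)

/-- The collar event is measurable. [folklore] -/
theorem measurableSet_reachFar (xe : W) (R : ℕ) (D : Finset (W × Site 2)) (o : W × Site 2) : MeasurableSet (reachFar X xe R D o) :=
  measurableSet_linkIn D {o} _

/-- The collar event is determined by the pairs inside `D`. [folklore] -/
theorem determinedBy_reachFar (xe : W) (R : ℕ) (D : Finset (W × Site 2)) (o : W × Site 2) :
    DeterminedBy (reachFar X xe R D o) (wireSet (↑D : Set (W × Site 2))) :=
  determinedBy_linkIn _ _ _ le_rfl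

/-- **Inside a region of planar extent `Λ_n` within the window, the collar event is a fibre reach event.** [folklore] -/
theorem reachFar_subset_fibReach {xe : W} {R Rw n : ℕ} {D : Finset (W × Site 2)} (hD : D ⊆ ballFin X xe Rw ×ˢ box 2 n)
    {o : W × Site 2} (ho : o ∈ D) : reachFar X xe R D o ⊆ fibReach X xe n R o := by
  intro ω hω
  rw [reachFar, mem_linkIn_iff] at hω
  obtain ⟨o', ho', v, hv, hc⟩ := hω
  rw [Finset.mem_singleton] at ho'
  rw [ho'] at hc
  obtain ⟨hvD, hvfar⟩ := Finset.mem_filter.1 hv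
  refine ⟨v, ⟨⟨Rw, (mem_ballFin X).1 (Finset.mem_product.1 (hD hvD)).1⟩, fun h => hvfar ((mem_ballFin X).2 h)⟩, ?_⟩
  have hDtube : (↑D : Set (W × Site 2)) ⊆ tube W n := fun u hu =>
    (mem_tube n u).2 (Finset.mem_product.1 (hD (Finset.mem_coe.1 hu))).2
  have hc' : ω ∈ openConnVia (withinGraph ⊤ (↑D : Set (W × Site 2))) o v := by
    rw [← openConnIn_eq_openConnVia (Finset.mem_coe.2 ho)]; exact hc
  exact openClusterIn_mono_graph (withinGraph_mono _ hDtube) ω o hc'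

/-- `P_p(reachFar) ≤ P_p(fibReach)`. [folklore] -/
theorem prob_reachFar_le [Countable W] (p : unitInterval) {xe : W} {R Rw n : ℕ} {D : Finset (W × Site 2)}
    (hD : D ⊆ ballFin X xe Rw ×ˢ box 2 n) {o : W × Site 2} (ho : o ∈ D) :
    (bondPercolation (X □ zdGraph 2) p).real (reachFar X xe R D o) ≤ (bondPercolation (X □ zdGraph 2) p).real (fibReach X xe n R o) :=
  measureReal_mono (reachFar_subset_fibReach X hD ho) (measure_ne_top _ _)

/-- **The collar estimate** (under `P_p` on `X □ ℤ²`): for `η > 0` and a planar extent `n` there is `R₀` such that for all `R ≥ R₀`, all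
windows `Rw` and all regions `D ⊆ B_X(xe, Rw) × Λ_n` containing `o` (with `o.2 ∈ Λ_n`), `P_p(reachFar xe R D o) ≤ η` — the window radius
`Rw ≥ R + (cube data)` is chosen LAST. [cite: MartineauSevero2019, Cor. 2.2] -/
theorem exists_prob_reachFar_le [Countable W] {p : unitInterval} (hT : TubeSubcritical X p) (xe : W) {n : ℕ} {o : W × Site 2}
    (ho2 : o.2 ∈ box 2 n) {η : ℝ} (hη : 0 < η) :
    ∃ R₀ : ℕ, ∀ R, R₀ ≤ R → ∀ (Rw : ℕ) (D : Finset (W × Site 2)), D ⊆ ballFin X xe Rw ×ˢ box 2 n → o ∈ D →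
      (bondPercolation (X □ zdGraph 2) p).real (reachFar X xe R D o) ≤ η := by
  have h := (tendsto_prob_fibReach_of_tubeSubcritical X hT xe (a := o) ho2).eventually (Iic_mem_nhds hη)
  obtain ⟨R₀, hR₀⟩ := h.exists_forall_of_atTop
  exact ⟨R₀, fun R hR Rw D hD ho => (prob_reachFar_le X p hD ho).trans (hR₀ R hR)⟩

/-- **The collar event under the exploration's weighting**: for a subbox weighting `Wt` of the tube graph over `π` on `D ⊆ π × ℤ²`,
`P_{Wt}(reachFar) = P_p(reachFar)`. [folklore] -/
theorem real_reachFar_eq [Countable W] {π : Finset W} {Wt : Sym2 (W × Site 2) → unitInterval} {p : unitInterval} {D : Finset (W × Site 2)}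
    (hWD : IsSubbox (tubeGraph X π) Wt p D) (hDπ : ∀ v ∈ D, v.1 ∈ π) (xe : W) (R : ℕ) (o : W × Site 2) :
    (prodBernoulli Wt).real (reachFar X xe R D o) = (bondPercolation (X □ zdGraph 2) p).real (reachFar X xe R D o) := by
  rw [hWD.real_eq_bondPercolation (determinedBy_reachFar X xe R D o) (measurableSet_reachFar X xe R D o)]
  exact real_eq_of_determinedBy_window X p
    ((determinedBy_reachFar X xe R D o).mono (KozmaNitzan.wireSet_mono fun v hv => hDπ v (Finset.mem_coe.1 hv)))
    (measurableSet_reachFar X xe R D o)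

end BoxProdZ2

end Transplant

end Summit.CriticalPhenomena.PercolationContinuityZ3.Theorems

end
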